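import Literature.NumberTheory.EllipticCurves.KubertTateFiveEisensteinTwistMinimalModel
import Literature.Barriers.BirchSwinnertonDyer.AnomalousHeegnerLogWall
import HarnessLib

/-!
# CLASS-WIDE DICHOTOMY for the twists of the Kubert–Tate `5`-torsion family: every minimal model of a GAUSSIAN twist `E_{m,n}^{(-4)}`
# is an ANOMALOUS Eisenstein pair at `5` (behind the printed-scope wall), every minimal model of an EISENSTEIN twist `E_{m,n}^{(-3)}`
# is INSIDE the printed scope (`Red ∧ Good ∧ a₅ ≢ 1`)

PROOF-ONLY file (theorems only, no definition, no named fact, no `sorry`), topic `NumberTheory/EllipticCurves`; the class-wide form of the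
instances `…GaussianTwistDoor{133,14613,M919}Anomalous` (seat g21: "the same holds for every Gaussian-twist row") and the formal placement of the
Eisenstein twists of `KubertTateFiveEisensteinTwistMinimalModel` (seat g22).  Setting: `E = E_{m,n} = [n−m, −mn, −mn², 0, 0]` over `ℚ`, `m, n`
coprime (so `E` is globally minimal), `5 ∤ Δ(E)` (good at `5`; then `a₅(E) ≡ 1 (mod 5)` from the rational `5`-torsion point); `W'` a globally
minimal Weierstrass equation with a `ℚ`-isomorphism `C • W' = E.quadraticTwist d`.

* §1 `d = -4` (≅ the twist by `-1`; `5` SPLITS in `ℚ(i)`, `(−1/5) = +1`): `good_five_of_gaussian_model`, `red_five_of_gaussian_model`,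
  **`frobeniusTrace_five_of_gaussian_model : a₅(W') = a₅(E)`** (twisting formula, tree `frobeniusTrace_quadraticTwist_holds`, at the squarefree
  `d = -1` through `E^{(-4)} ≅ E^{(-1)}`), **`anom_five_of_gaussian_model : Anom W' 5`**, and **`not_printedScope_of_gaussian_model`** — by the
  tree's barrier `AnomalousHeegnerLogWall`, `(W', 5)` is OUTSIDE the printed scope of every refereed Heegner-log / BDP / Eisenstein
  `p`-converse theorem (CGLS 2022 Thm. E, CGS 2025 Thm. A assume `φ|_{G_p} ≠ 1, ω`).
* §2 `d = -3` (`5` INERT in `ℚ(√-3)`, `(−3/5) = −1`): **`printedScope_of_eisenstein_model : PrintedEisensteinHeegnerLogScope W' 5`** — the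
  Eisenstein twists are INSIDE the printed scope (`a₅(W') = -a₅(E) ≡ -1`), class-wide.
* §3 `twist_scope_dichotomy` — both halves in one statement.

Why (stmt-BirchSwinnertonDyer-22356, «T = FiniteShaComponentTransfer»): the doors at `5` opened by descent over ℚ(i) (Gaussian twists) can
never be fed to a refereed `5`-converse, those opened by descent over `ℚ(ζ₃)` (Eisenstein twists) always can (ranks `0, 1`).  Neither BSD nor T is
proved by this.

## References

* [KrizLi2019] D. Kriz, C. Li, *Goldfeld's conjecture and congruences between Heegner points*, Forum Math. Sigma 7 (2019), Thm. 1.12.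
* [CastellaGrossiLeeSkinner2022] F. Castella, G. Grossi, J. Lee, C. Skinner, Invent. Math. 227 (2022), Thm. E (hypothesis `φ|G_p ≠ 1, ω`).
* [RubinSilverberg2002] K. Rubin, A. Silverberg, *Ranks of elliptic curves*, Bull. AMS 39 (2002), §1 (twisting formula).
* [SilvermanAEC2009] J. H. Silverman, *AEC*, 2nd ed., VII.3.1(b), X.§2, Exercise 10.16.
-/

noncomputable section

open scoped Classical
open WeierstrassCurve Literature.NumberTheory.EllipticCurves
open Literature.NumberTheory.EllipticCurves.KubertTateVelu
open Literature.NumberTheory.EllipticCurves.Rank1Residual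
open Literature.Barriers.BirchSwinnertonDyer

namespace Literature.NumberTheory.EllipticCurves

namespace KubertTateEisensteinTwist

variable (m n : ℤ) [hEQ : (kubertTateFive (m : ℚ) (n : ℚ)).IsElliptic]

/-! ## §1 The Gaussian twists `E_{m,n}^{(-4)}`: always ANOMALOUS at `5` -/

omit hEQ in
/-- **The Gaussian twist model is integral: `E_{m,n}^{(-4)} = [0, −b₂, 0, 8b₄, −16b₆] ⊗ ℚ`.** [cite: SilvermanAEC2009, X.§2] -/
theorem quadraticTwist_neg_four_eq_map :
    (kubertTateFive (m : ℚ) (n : ℚ)).quadraticTwist (-4) =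
      (⟨0, -(kubertTateFive m n).b₂, 0, 8 * (kubertTateFive m n).b₄, -16 * (kubertTateFive m n).b₆⟩ :
        WeierstrassCurve ℤ).map (Int.castRingHom ℚ) := by
  have hb₂ : (kubertTateFive (m : ℚ) (n : ℚ)).b₂ = ((kubertTateFive m n).b₂ : ℚ) := by
    rw [eq_map_int m n, map_b₂]; rfl
  have hb₄ : (kubertTateFive (m : ℚ) (n : ℚ)).b₄ = ((kubertTateFive m n).b₄ : ℚ) := by
    rw [eq_map_int m n, map_b₄]; rfl
  have hb₆ : (kubertTateFive (m : ℚ) (n : ℚ)).b₆ = ((kubertTateFive m n).b₆ : ℚ) := by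
    rw [eq_map_int m n, map_b₆]; rfl
  ext
  · simp [quadraticTwist, WeierstrassCurve.map]
  · simp only [quadraticTwist, WeierstrassCurve.map, hb₂, eq_intCast, Int.cast_neg]; ring
  · simp [quadraticTwist, WeierstrassCurve.map]
  · simp only [quadraticTwist, WeierstrassCurve.map, hb₄, eq_intCast, Int.cast_mul, Int.cast_ofNat]; ring
  · simp only [quadraticTwist, WeierstrassCurve.map, hb₆, eq_intCast, Int.cast_mul, Int.cast_neg, Int.cast_ofNat]; ring

omit hEQ in
/-- `Δ(E^{(-4)}/ℤ) = 4⁶ · Δ(E/ℤ)`. [cite: SilvermanAEC2009, X.§2] -/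
theorem Δ_neg_four_model :
    (⟨0, -(kubertTateFive m n).b₂, 0, 8 * (kubertTateFive m n).b₄, -16 * (kubertTateFive m n).b₆⟩ : WeierstrassCurve ℤ).Δ =
      4 ^ 6 * (kubertTateFive m n).Δ := by
  apply Int.cast_injective (α := ℚ)
  have h := congrArg WeierstrassCurve.Δ (quadraticTwist_neg_four_eq_map m n)
  rw [map_Δ, quadraticTwist_Δ, eq_map_int m n, map_Δ] at h
  rw [eq_intCast] at h
  push_cast at h ⊢
  linear_combination -h

/-- **Every model `W'` of the Gaussian twist `E_{m,n}^{(-4)}` has GOOD reduction at `5`** (`5 ∤ Δ(E)`; the integral model has the `5`-unit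
discriminant `4⁶Δ(E)`; isomorphism invariance). [cite: SilvermanAEC2009, VII.5 Prop. 5.1(a) and X.§2] -/
theorem good_five_of_gaussian_model (h5 : ¬ (5 : ℤ) ∣ (kubertTateFive m n).Δ) (W' : WeierstrassCurve ℚ) (C : VariableChange ℚ)
    (hC : C • W' = (kubertTateFive (m : ℚ) (n : ℚ)).quadraticTwist (-4)) :
    haveI : Fact (Nat.Prime 5) := ⟨Nat.prime_five⟩
    W'.HasGoodReductionAtPrime 5 := by
  haveI : Fact (Nat.Prime 5) := ⟨Nat.prime_five⟩
  haveI h4 : ((kubertTateFive (m : ℚ) (n : ℚ)).quadraticTwist (-4)).IsElliptic := isElliptic_quadraticTwist _ (by norm_num)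
  have hgood : ((kubertTateFive (m : ℚ) (n : ℚ)).quadraticTwist (-4)).HasGoodReductionAtPrime 5 := by
    refine hasGoodReductionAtPrime_of_map_int_of_not_dvd _ _ (quadraticTwist_neg_four_eq_map m n).symm 5 ?_
    rw [Δ_neg_four_model]
    intro h
    have h5p : Prime (5 : ℤ) := by norm_num
    rcases h5p.dvd_or_dvd h with h' | h'
    · exact absurd (h5p.dvd_of_dvd_pow h') (by norm_num)
    · exact h5 h'
  rw [← hasGoodReductionAtPrime_iff_of_variableChange W' C 5, hC]
  exact hgood

/-- **`W'[5]` is reducible for every model `W'` of `E_{m,n}^{(-4)}`.** [cite: SilvermanAEC2009, X.5 Cor. 5.4] -/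
theorem red_five_of_gaussian_model (W' : WeierstrassCurve ℚ) [W'.IsElliptic] (C : VariableChange ℚ)
    (hC : C • W' = (kubertTateFive (m : ℚ) (n : ℚ)).quadraticTwist (-4)) :
    haveI : Fact (Nat.Prime 5) := ⟨Nat.prime_five⟩
    ¬ W'.HasIrreducibleModPGaloisRep 5 := by
  haveI : Fact (Nat.Prime 5) := ⟨Nat.prime_five⟩
  exact not_hasIrreducibleModPGaloisRep_twist (red_five m n) (d := -4) (by norm_num) W' C hC

/-- `(−1/5) = +1`: `5` splits in `ℚ(i)`. [folklore] -/
private theorem legendreSym_five_neg_one : haveI : Fact (Nat.Prime 5) := ⟨Nat.prime_five⟩; legendreSym 5 (-1) = 1 := by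
  haveI : Fact (Nat.Prime 5) := ⟨Nat.prime_five⟩
  decide

/-- `-1` is squarefree. [folklore] -/
private theorem squarefree_neg_one : Squarefree (-1 : ℤ) := by
  rw [← Int.squarefree_natAbs, show (-1 : ℤ).natAbs = 1 by norm_num]
  exact squarefree_one

/-- **`a₅(W') = a₅(E_{m,n})` for every globally minimal model `W'` of the Gaussian twist `E_{m,n}^{(-4)}`** (coprime `m, n`, `5 ∤ Δ(E)`): the
twisting formula at the squarefree `d = -1` (`E^{(-4)} ≅ E^{(-1)}`, tree `exists_variableChange_quadraticTwist_mul_sq`) with `(−1/5) = +1` —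
`5` SPLITS in `ℚ(i)`. [cite: RubinSilverberg2002, §1] [cite: SilvermanAEC2009, Exercise 10.16] -/
theorem frobeniusTrace_five_of_gaussian_model (hcop : IsCoprime m n) (h5 : ¬ (5 : ℤ) ∣ (kubertTateFive m n).Δ)
    (W' : WeierstrassCurve ℚ) [W'.IsGloballyMinimal] (C : VariableChange ℚ)
    (hC : C • W' = (kubertTateFive (m : ℚ) (n : ℚ)).quadraticTwist (-4)) :
    haveI := isGloballyMinimal_kubertTateFive_of_isCoprime m n hcop
    haveI : Fact (Nat.Prime 5) := ⟨Nat.prime_five⟩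
    W'.frobeniusTrace 5 = (kubertTateFive (m : ℚ) (n : ℚ)).frobeniusTrace 5 := by
  haveI := isGloballyMinimal_kubertTateFive_of_isCoprime m n hcop
  haveI : Fact (Nat.Prime 5) := ⟨Nat.prime_five⟩
  -- `E^{(-4)} ≅ E^{(-1)}`: `C₂ • E^{(-1)} = E^{(-1·2²)} = E^{(-4)}`, so `(C₂⁻¹ * C) • W' = E^{(-1)}`
  obtain ⟨C₂, hC₂⟩ := (kubertTateFive (m : ℚ) (n : ℚ)).exists_variableChange_quadraticTwist_mul_sq (-1) 2 two_ne_zero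
  have e : (-1 : ℚ) * 2 ^ 2 = -4 := by norm_num
  rw [e] at hC₂
  have hC' : (C₂⁻¹ * C) • W' = (kubertTateFive (m : ℚ) (n : ℚ)).quadraticTwist (((-1 : ℤ)) : ℚ) := by
    rw [mul_smul, hC, ← hC₂, inv_smul_smul]; norm_num
  have h := frobeniusTrace_quadraticTwist_holds (kubertTateFive (m : ℚ) (n : ℚ)) W' (-1) squarefree_neg_one
    ⟨C₂⁻¹ * C, hC'⟩ 5 (by norm_num) (by rw [minimalDiscriminantInt_eq m n hcop]; exact_mod_cast h5)
  rw [h, legendreSym_five_neg_one]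
  ring

/-- **Every globally minimal model of a Gaussian twist `E_{m,n}^{(-4)}` is an ANOMALOUS Eisenstein pair at `5`**: `W'[5]` reducible, good at `5`,
`a₅(W') = a₅(E) ≡ 1 (mod 5)` (`m, n` coprime, `5 ∤ Δ(E)`). Class-wide form of the tree's instances `…GaussianTwistDoor*Anomalous`.
[cite: KrizLi2019, Thm. 1.12 (first bullet)] [cite: SilvermanAEC2009, VII.3.1(b)] -/
theorem anom_five_of_gaussian_model (hcop : IsCoprime m n) (h5 : ¬ (5 : ℤ) ∣ (kubertTateFive m n).Δ)
    (W' : WeierstrassCurve ℚ) [W'.IsElliptic] [W'.IsGloballyMinimal] (C : VariableChange ℚ)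
    (hC : C • W' = (kubertTateFive (m : ℚ) (n : ℚ)).quadraticTwist (-4)) :
    haveI : Fact (Nat.Prime 5) := ⟨Nat.prime_five⟩
    Anom W' 5 := by
  haveI : Fact (Nat.Prime 5) := ⟨Nat.prime_five⟩
  haveI := isGloballyMinimal_kubertTateFive_of_isCoprime m n hcop
  refine ⟨red_five_of_gaussian_model m n W' C hC, good_five_of_gaussian_model m n h5 W' C hC, ?_⟩
  rw [frobeniusTrace_five_of_gaussian_model m n hcop h5 W' C hC]
  exact five_dvd_frobeniusTrace_sub_one m n hcop h5

/-- **Every globally minimal model of a Gaussian twist `E_{m,n}^{(-4)}` lies OUTSIDE the printed scope of the refereed Heegner-log / BDP-value /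
Eisenstein `p`-converse theorems at `5`** (tree barrier `AnomalousHeegnerLogWall`). [cite: CastellaGrossiLeeSkinner2022, Thm. E (hypothesis φ|G_p ≠ 1, ω)]
[cite: KrizLi2019, Thm. 1.12 (first bullet)] -/
theorem not_printedScope_of_gaussian_model (hcop : IsCoprime m n) (h5 : ¬ (5 : ℤ) ∣ (kubertTateFive m n).Δ)
    (W' : WeierstrassCurve ℚ) [W'.IsElliptic] [W'.IsGloballyMinimal] (C : VariableChange ℚ)
    (hC : C • W' = (kubertTateFive (m : ℚ) (n : ℚ)).quadraticTwist (-4)) :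
    haveI : Fact (Nat.Prime 5) := ⟨Nat.prime_five⟩
    ¬ PrintedEisensteinHeegnerLogScope W' 5 := by
  haveI : Fact (Nat.Prime 5) := ⟨Nat.prime_five⟩
  exact AnomalousHeegnerLogWall.not_printedScope_of_anom (anom_five_of_gaussian_model m n hcop h5 W' C hC)

/-! ## §2 The Eisenstein twists `E_{m,n}^{(-3)}`: always INSIDE the printed scope -/

/-- **Every globally minimal model of an Eisenstein twist `E_{m,n}^{(-3)}` lies INSIDE the printed scope** `Red ∧ Good ∧ a₅ ≢ 1 (mod 5)` of the
refereed Eisenstein `p`-converse theorems at `5` (`a₅(W') = -a₅(E) ≡ -1`; tree `KubertTateFiveEisensteinTwistMinimalModel`).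
[cite: CastellaGrossiLeeSkinner2022, Thm. E (hypothesis φ|G_p ≠ 1, ω)] [cite: RubinSilverberg2002, §1] -/
theorem printedScope_of_eisenstein_model (hcop : IsCoprime m n) (h5 : ¬ (5 : ℤ) ∣ (kubertTateFive m n).Δ)
    (W' : WeierstrassCurve ℚ) [W'.IsElliptic] [W'.IsGloballyMinimal] (C : VariableChange ℚ)
    (hC : C • W' = (kubertTateFive (m : ℚ) (n : ℚ)).quadraticTwist (-3)) :
    haveI : Fact (Nat.Prime 5) := ⟨Nat.prime_five⟩
    PrintedEisensteinHeegnerLogScope W' 5 := by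
  haveI : Fact (Nat.Prime 5) := ⟨Nat.prime_five⟩
  obtain ⟨hgood, hred, hna⟩ := good_red_not_anom_five_of_model m n hcop h5 W' C hC
  exact ⟨hred, hgood, fun hdvd ↦ hna ⟨hred, hgood, hdvd⟩⟩

/-! ## §3 The dichotomy -/

/-- **THE TWIST-SCOPE DICHOTOMY AT `5` (class-wide).** For coprime `m, n` with `5 ∤ Δ(E_{m,n})`: every globally minimal model of the GAUSSIAN twist
`E_{m,n}^{(-4)}` is OUTSIDE, and every globally minimal model of the EISENSTEIN twist `E_{m,n}^{(-3)}` is INSIDE, the printed scope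
`PrintedEisensteinHeegnerLogScope · 5` of the refereed Eisenstein `5`-converse theorems — because `5` splits in `ℚ(i)` and is inert in `ℚ(√-3)`.
[cite: CastellaGrossiLeeSkinner2022, Thm. E] [cite: KrizLi2019, Thm. 1.12 (first bullet)] -/
theorem twist_scope_dichotomy (hcop : IsCoprime m n) (h5 : ¬ (5 : ℤ) ∣ (kubertTateFive m n).Δ)
    (W₄ W₃ : WeierstrassCurve ℚ) [W₄.IsElliptic] [W₄.IsGloballyMinimal] [W₃.IsElliptic] [W₃.IsGloballyMinimal] (C₄ C₃ : VariableChange ℚ)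
    (hC₄ : C₄ • W₄ = (kubertTateFive (m : ℚ) (n : ℚ)).quadraticTwist (-4))
    (hC₃ : C₃ • W₃ = (kubertTateFive (m : ℚ) (n : ℚ)).quadraticTwist (-3)) :
    haveI : Fact (Nat.Prime 5) := ⟨Nat.prime_five⟩
    ¬ PrintedEisensteinHeegnerLogScope W₄ 5 ∧ PrintedEisensteinHeegnerLogScope W₃ 5 :=
  ⟨not_printedScope_of_gaussian_model m n hcop h5 W₄ C₄ hC₄, printedScope_of_eisenstein_model m n hcop h5 W₃ C₃ hC₃⟩

end KubertTateEisensteinTwist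

end Literature.NumberTheory.EllipticCurves

end
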